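import Summits.BirchSwinnertonDyer.BirchSwinnertonDyer.Theorems.SchneiderFreeAdditiveX3BranchIMCRebaseCovolume
import Summits.BirchSwinnertonDyer.Rank1Residual.Additive.GordManinConstantTwistDegree
import Summits.BirchSwinnertonDyer.Rank1Residual.Additive.TypeGThree
import Summits.BirchSwinnertonDyer.Rank1Residual.Additive.DictionaryUniform
import HarnessLib

/-!
# Schneider-free additive X3 door, SECOND WING — the SCALING OF THE DOOR'S PRESENTATION IS A `p`-ADIC UNIT
# (`ord_p Δ_min = 6` on the (G-ord, `e = 2`) cell at every odd `p`; `ord_p(u_{C₂}·u_D) = 0`) — the exactness the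
# UNIT reading of the descended Castella–Hsieh cofactor needs

Cell `bsd-schneider-ideate` (HOME `run/shared/lean/pub/bsd-schneider-ideate/`), seat `bsd-schneider-door-c5` (prover,
generation 11). PARTITION: board row B6 ∩ X3 ∩ sst-twist, `r = 1`, (G-ord, `e = 2`) half (2 560 of 7 101 pairs) of
`Rank1Residual.partition`; types-the-object-of ONE arithmetic input of the upper wing's value reading; closes nothing;
BSD is NOT advanced.

WHY. The typed fact `castellaHsieh2018_branchValue_conductorP` (p507031, Castella–Hsieh Lemma 5.4 + Thm. 5.7) gives the
conductor-`p` value as `u · p⁻¹ · (log_{ω_{W′}} z / c)²`, `u ∈ R₀ˣ`, for the UNDESCENDED class `z` on the good-ordinary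
partner `W′`; door-c3 gen 10's descent theorem (`…KYReadLogDescent.lean`) reads `(log_{ω_{W′}} z)² = p*·(u_{C₂}u_D)⁻²·
(log_{ω_W} Q)²` for the door's presentation `W = C₂ • ((D • W′) ⊗ χ_{p*})` and the descended point `Q ∈ W(K)`. Hence
the cofactor of `(log_{ω_W} Q / c)²` is `± u · (u_{C₂}u_D)⁻²`: a UNIT — which is what the upper wing's socket
`KYRead.KYReadCHValueUnit[H]` asks — iff `ord_p(u_{C₂}·u_D) = 0`. This file proves exactly that, for EVERY presentation
of the shape the door uses (`W′`, `W` globally minimal, `ord_p Δ_min(W′) = 0`, `W` on X3 ∩ (G-ord, `e = 2`), `p` odd):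

* §1 `padicValInt_minimalDiscriminantInt_eq_six_of_subGordTwo` — `ord_p Δ_min(W) = 6` on the cell at every odd `p`
  (`p = 3`: the cell's `TypeG`-at-3 theorem; `p ≥ 5`: Kodaira list `{2,3,4,6,8,9,10}` ∩ `{v ≡ 6 (mod 12)}`).
* §2 `padicValRat_presentation_u_mul_eq_zero` — `ord_p(u(C₂)·u(D)) = 0` (discriminants: `Δ_W = u(C₂)⁻¹²·(p*)⁶·
  u(D)⁻¹²·Δ_{W′}`, so `6 = 6 − 12·ord_p(u(C₂)u(D))`); `padicValRat_presentation_u_eq_zero` — with `D = toCharNeTwoNF`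
  (`u(D) = 1`), `ord_p u(C₂) = 0`.

HONEST FRAMING: elementary arithmetic of minimal models; CONDITIONAL on nothing; it does NOT discharge the value
socket (that needs the typed fact + Keller–Yin's frame claims + the descent + the embedding compatibility, door-c3's
chain); it settles the one valuation question the unit reading raised (referee g34/g35, door-c3 07:10Z flag).

References: Silverman AEC III.1 Table 3.1 (`Δ` under a change of variables), VII/VIII (minimal models); Silverman ATAEC
IV Table 4.1 (Kodaira types, `p ≥ 5`); Castella–Hsieh Math. Ann. 370 (2018) Thm. 5.7 (the constant being descended).
-/

noncomputable section

open scoped Classical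

open WeierstrassCurve Literature.NumberTheory.EllipticCurves
  Literature.NumberTheory.EllipticCurves.Rank1Residual
  Summit.BirchSwinnertonDyer.Rank1Residual Summit.BirchSwinnertonDyer.Rank1Residual.Additive

set_option linter.dupNamespace false
set_option autoImplicit false

namespace Summit.BirchSwinnertonDyer.BirchSwinnertonDyer.Theorems.SchneiderFree.Upper

/-! ### §1 `ord_p Δ_min = 6` on the (G-ord, `e = 2`) cell, every odd `p` -/

/-- **`ord_p Δ_min(W) = 6` on X3 ∩ (G-ord, `e = 2`) at every odd `p`.** At `p = 3`: `SubGord ⟺ TypeG`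
(`subGord_iff_typeG_of_addv`) and the cell's `padicValInt_minimalDiscriminantInt_eq_six_of_typeG`. At `p ≥ 5`: `W` is
additive and potentially good (`¬ PotMult`, i.e. `ord_p j ≥ 0`), so `ord_p Δ_min ∈ {2,3,4,6,8,9,10}`
(`padicValInt_minimalDiscriminantInt_mem_of_addv_of_padicValRat_j_nonneg`), and `e = 2 ⟺ ord_p Δ_min ≡ 6 (mod 12)`
(`semistabilityIndex_eq_two_iff`) leaves `6`. [cite: SilvermanATAEC1994, IV Table 4.1 (PDF p. 365)] -/
theorem padicValInt_minimalDiscriminantInt_eq_six_of_subGordTwo {p : ℕ} [Fact p.Prime] (hp2 : p ≠ 2)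
    (W : WeierstrassCurve ℚ) [W.IsElliptic] [W.IsGloballyMinimal] (hX : ClassX3 W p)
    (hS : Additive.SubGordTwo W p) : padicValInt p W.minimalDiscriminantInt = 6 := by
  have hp : p.Prime := Fact.out
  have hv : padicValInt p W.minimalDiscriminantInt % 12 = 6 :=
    (Additive.semistabilityIndex_eq_two_iff W p).mp hS.2
  by_cases hp3 : p = 3
  · subst hp3
    have hG : TypeG W 3 := (subGord_iff_typeG_of_addv W 3 hp2 hX.2).mp hS.1
    exact padicValInt_minimalDiscriminantInt_eq_six_of_typeG W hG hX.2.1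
  · have h4 : p ≠ 4 := by rintro rfl; exact absurd hp (by decide)
    have hp5 : 5 ≤ p := by have := hp.two_le; omega
    obtain ⟨⟨hnot, -, -⟩, -⟩ := hS
    have hj : 0 ≤ padicValRat p W.j := not_lt.mp hnot
    rcases padicValInt_minimalDiscriminantInt_mem_of_addv_of_padicValRat_j_nonneg W p hp5 hX.2 hj with
      h | h | h | h | h | h | h <;> omega

/-! ### §2 The scaling of the door's presentation is a `p`-adic unit -/

/-- **`ord_p(u(C₂)·u(D)) = 0` for the door's presentation.** Let `W′/ℚ` be globally minimal with `ord_p Δ_min(W′) = 0`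
(good reduction at `p`), `D`, `C₂` changes of variables with `W := C₂ • ((D • W′) ⊗ χ_{p*})` globally minimal on
X3 ∩ (G-ord, `e = 2`), `p` odd. Then `Δ_W = u(C₂)⁻¹²·(p*)⁶·u(D)⁻¹²·Δ_{W′}`, so `ord_p Δ_W = 6 − 12·ord_p(u(C₂)u(D))`,
and §1 gives `ord_p(u(C₂)·u(D)) = 0`. This is the valuation that makes the DESCENDED Castella–Hsieh cofactor
`± u · (u(C₂)u(D))⁻²` a unit (door-c3's descent `(log_{ω_{W′}} z)² = p*·(u_{C₂}u_D)⁻²·(log_{ω_W} Q)²` against the typed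
`u · p⁻¹ · (log z / c)²`). [cite: SilvermanAEC2009, III.1 Table 3.1 (PDF p. 50)] -/
theorem padicValRat_presentation_u_mul_eq_zero {p : ℕ} [Fact p.Prime] (hp2 : p ≠ 2)
    (W' : WeierstrassCurve ℚ) [W'.IsElliptic] [W'.IsGloballyMinimal]
    (hΔ' : padicValInt p W'.minimalDiscriminantInt = 0) (D C₂ : VariableChange ℚ)
    [(C₂ • (D • W').quadraticTwist ((-1 : ℚ) ^ (p / 2) * p)).IsElliptic]
    [(C₂ • (D • W').quadraticTwist ((-1 : ℚ) ^ (p / 2) * p)).IsGloballyMinimal]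
    (hX : ClassX3 (C₂ • (D • W').quadraticTwist ((-1 : ℚ) ^ (p / 2) * p)) p)
    (hS : Additive.SubGordTwo (C₂ • (D • W').quadraticTwist ((-1 : ℚ) ^ (p / 2) * p)) p) :
    padicValRat p ((C₂.u : ℚ) * D.u) = 0 := by
  have hp : p.Prime := Fact.out
  obtain ⟨hcast, hd⟩ := Additive.pStar_intCast p
  set d : ℤ := (-1 : ℤ) ^ (p / 2) * p with hddef
  have h6 := padicValInt_minimalDiscriminantInt_eq_six_of_subGordTwo hp2
    (C₂ • (D • W').quadraticTwist ((-1 : ℚ) ^ (p / 2) * p)) hX hS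
  have hu2 : (C₂.u : ℚ) ≠ 0 := C₂.u.ne_zero
  have huD : (D.u : ℚ) ≠ 0 := D.u.ne_zero
  have hd0 : (d : ℚ) ≠ 0 := by
    rcases hd with h | h <;> rw [h] <;> push_cast <;> simp [hp.ne_zero]
  have hΔ'0 : (W'.minimalDiscriminantInt : ℚ) ≠ 0 := by exact_mod_cast W'.minimalDiscriminantInt_ne_zero
  have hdv : padicValRat p (d : ℚ) = 1 := by
    rcases hd with h | h <;> rw [h]
    · push_cast; exact_mod_cast padicValRat.self hp.one_lt
    · push_cast; rw [padicValRat.neg]; exact_mod_cast padicValRat.self hp.one_lt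
  -- the discriminant of the presentation
  have hΔ : ((C₂ • (D • W').quadraticTwist ((-1 : ℚ) ^ (p / 2) * p)).minimalDiscriminantInt : ℚ) =
      (C₂.u : ℚ)⁻¹ ^ 12 * ((d : ℚ) ^ 6 * ((D.u : ℚ)⁻¹ ^ 12 * W'.minimalDiscriminantInt)) := by
    rw [cast_minimalDiscriminantInt, cast_minimalDiscriminantInt, hcast, variableChange_Δ, quadraticTwist_Δ,
      variableChange_Δ, Units.val_inv_eq_inv_val, Units.val_inv_eq_inv_val]
  have key : (padicValInt p (C₂ • (D • W').quadraticTwist ((-1 : ℚ) ^ (p / 2) * p)).minimalDiscriminantInt : ℤ) =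
      padicValRat p ((C₂.u : ℚ)⁻¹ ^ 12 * ((d : ℚ) ^ 6 * ((D.u : ℚ)⁻¹ ^ 12 * W'.minimalDiscriminantInt))) := by
    rw [← padicValRat.of_int, hΔ]
  rw [padicValRat.mul (pow_ne_zero _ (inv_ne_zero hu2))
      (mul_ne_zero (pow_ne_zero _ hd0) (mul_ne_zero (pow_ne_zero _ (inv_ne_zero huD)) hΔ'0)),
    padicValRat.mul (pow_ne_zero _ hd0) (mul_ne_zero (pow_ne_zero _ (inv_ne_zero huD)) hΔ'0),
    padicValRat.mul (pow_ne_zero _ (inv_ne_zero huD)) hΔ'0,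
    padicValRat.pow, padicValRat.pow, padicValRat.pow, padicValRat.inv, padicValRat.inv, hdv,
    padicValRat.of_int, h6, hΔ'] at key
  simp only [Nat.cast_ofNat, mul_one, Nat.cast_zero, add_zero] at key
  rw [padicValRat.mul hu2 huD]
  linarith

/-- **`ord_p u(C₂) = 0` for the door's presentation with `D = toCharNeTwoNF W′`** (whose scaling is `u(D) = 1`) — the
form in which `exists_goodOrd_partner_presentation_of_subGordTwo_odd` delivers the door's curve.
[cite: SilvermanAEC2009, III.1 Table 3.1 (PDF p. 50)] -/
theorem padicValRat_presentation_u_eq_zero {p : ℕ} [Fact p.Prime] (hp2 : p ≠ 2)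
    (W' : WeierstrassCurve ℚ) [W'.IsElliptic] [W'.IsGloballyMinimal]
    (hΔ' : padicValInt p W'.minimalDiscriminantInt = 0) (C₂ : VariableChange ℚ)
    [(C₂ • ((@WeierstrassCurve.toCharNeTwoNF ℚ _ W' (invertibleOfNonzero two_ne_zero)) • W').quadraticTwist
        ((-1 : ℚ) ^ (p / 2) * p)).IsElliptic]
    [(C₂ • ((@WeierstrassCurve.toCharNeTwoNF ℚ _ W' (invertibleOfNonzero two_ne_zero)) • W').quadraticTwist
        ((-1 : ℚ) ^ (p / 2) * p)).IsGloballyMinimal]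
    (hX : ClassX3 (C₂ • ((@WeierstrassCurve.toCharNeTwoNF ℚ _ W' (invertibleOfNonzero two_ne_zero)) •
      W').quadraticTwist ((-1 : ℚ) ^ (p / 2) * p)) p)
    (hS : Additive.SubGordTwo (C₂ • ((@WeierstrassCurve.toCharNeTwoNF ℚ _ W' (invertibleOfNonzero two_ne_zero)) •
      W').quadraticTwist ((-1 : ℚ) ^ (p / 2) * p)) p) :
    padicValRat p (C₂.u : ℚ) = 0 := by
  have h := padicValRat_presentation_u_mul_eq_zero hp2 W' hΔ' _ C₂ hX hS
  have hu : ((@WeierstrassCurve.toCharNeTwoNF ℚ _ W' (invertibleOfNonzero two_ne_zero)).u : ℚ) = 1 := rfl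
  rwa [hu, mul_one] at h

/-- **The same conclusion from the cell hypotheses alone, through the door's presentation theorem**: for `W` on
X3 ∩ (G-ord, `e = 2`), `p` odd, the partner `W′` and the change `C₂` delivered by
`exists_goodOrd_partner_presentation_of_subGordTwo_odd` satisfy `ord_p u(C₂) = 0`. (Existential packaging for
consumers that open the presentation themselves.) [cite: SilvermanAEC2009, III.1 Table 3.1 (PDF p. 50)] -/
theorem exists_goodOrd_partner_presentation_unit_of_subGordTwo_odd {p : ℕ} [Fact p.Prime] (hp2 : p ≠ 2)
    (W : WeierstrassCurve ℚ) [W.IsElliptic] [W.IsGloballyMinimal] (hX : ClassX3 W p)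
    (hS : Additive.SubGordTwo W p) :
    ∃ (W' : WeierstrassCurve ℚ) (_ : W'.IsElliptic) (_ : W'.IsGloballyMinimal) (C₂ : VariableChange ℚ),
      C₂ • ((@WeierstrassCurve.toCharNeTwoNF ℚ _ W' (invertibleOfNonzero two_ne_zero)) • W').quadraticTwist
          ((-1 : ℚ) ^ (p / 2) * p) = W ∧
        GoodOrd W' p ∧ padicValInt p W'.minimalDiscriminantInt = 0 ∧ padicValRat p (C₂.u : ℚ) = 0 := by
  obtain ⟨W', hE', hmin', C₂, hW, hord, hΔ⟩ := exists_goodOrd_partner_presentation_of_subGordTwo_odd hp2 W hX hS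
  refine ⟨W', hE', hmin', C₂, hW, hord, hΔ, ?_⟩
  subst hW
  exact padicValRat_presentation_u_eq_zero hp2 W' hΔ C₂ hX hS

end Summit.BirchSwinnertonDyer.BirchSwinnertonDyer.Theorems.SchneiderFree.Upper

end
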